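import Literature.NumberTheory.Multiplicative.SmoothNumbersRankinTail
import Literature.NumberTheory.LFunctions.MertensElementary
import HarnessLib

/-!
# Route `ChenParityOracleBLAP` — crux S1 = `HostParityFromBrick` (stmt-Parity-20045): the sparse set of integers with a large smooth divisor

Support file for the prime half `K1 → K2 → HP1` of S1, sifting step (S): the integers `k ≤ u`
having an `N`-smooth divisor `e ≥ Y` are few.  Rankin's trick with the tree's
`SmoothRankin.sum_inv_smooth_tail_le` / `prod_inv_one_sub_rpow_le_exp` and an elementary
Mertens-type bound with a convexity refinement (`sum_primesBelow_rpow_sub_one_le`: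
`∑_{p<N} p^{σ−1} ≤ log log N + 4 + 3(e^c − 1)` for `σ = c/log N`) give
`#{k ≤ u : ∃ e ∣ k, e N-smooth, e ≥ Y} ≤ u · Y^{−σ} · exp(4(log log N + 4 + 3(e^c−1)))`
(`card_largeSmoothDivisor_le`).

References: G. Tenenbaum, *Introduction to Analytic and Probabilistic Number Theory* (2015),
Ch. III.5 [Tenenbaum2015]; G. H. Hardy, E. M. Wright, *An Introduction to the Theory of Numbers*,
Thm 427 [HardyWright2008].
-/

namespace Summit.Parity.GeneralizedHardyLittlewood.Theorems

open Finset Real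

/-- Convexity: `exp(c s) ≤ 1 + s (e^c − 1)` for `0 ≤ s ≤ 1`. -/
theorem exp_mul_le_one_add_of_unit {c s : ℝ} (hs0 : 0 ≤ s) (hs1 : s ≤ 1) :
    Real.exp (c * s) ≤ 1 + s * (Real.exp c - 1) := by
  have h := convexOn_exp.2 (Set.mem_univ (0 : ℝ)) (Set.mem_univ c) (by linarith : 0 ≤ 1 - s) hs0
    (by ring)
  simp only [smul_eq_mul, mul_zero, zero_add, Real.exp_zero] at h
  calc Real.exp (c * s) = Real.exp (s * c) := by rw [mul_comm]
    _ ≤ (1 - s) * 1 + s * Real.exp c := by simpa using h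
    _ = 1 + s * (Real.exp c - 1) := by ring

/-- **Refined Mertens bound.**  For `N ≥ 2`, `c ≥ 0` and `σ = c/log N`:
`∑_{p < N} p^{σ−1} ≤ log log N + 4 + 3(e^c − 1)`
(`p^σ ≤ 1 + (e^c−1) log p/log N` by convexity, then `∑ 1/p ≤ log log N + 4` and
`∑ log p/p ≤ log N + log 4`) [cite: HardyWright2008, Theorem 427]. -/
theorem sum_primesBelow_rpow_sub_one_le {N : ℕ} (hN : 2 ≤ N) {c : ℝ} (hc : 0 ≤ c) :
    ∑ p ∈ N.primesBelow, (p : ℝ) ^ (c / Real.log N - 1) ≤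
      Real.log (Real.log N) + 4 + 3 * (Real.exp c - 1) := by
  have hN2 : (2 : ℝ) ≤ N := by exact_mod_cast hN
  have hlogN : 0 < Real.log N := Real.log_pos (by linarith)
  have hec : 0 ≤ Real.exp c - 1 := by linarith [Real.add_one_le_exp c]
  -- pointwise
  have hpt : ∀ p ∈ N.primesBelow, (p : ℝ) ^ (c / Real.log N - 1) ≤
      1 / p + (Real.exp c - 1) / Real.log N * (Real.log p / p) := by
    intro p hp
    have hp' := (Nat.mem_primesBelow.1 hp)
    have hpN : p < N := hp'.1
    have hpp : p.Prime := hp'.2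
    have hp0 : (0 : ℝ) < p := by exact_mod_cast hpp.pos
    have hp1 : (1 : ℝ) < p := by exact_mod_cast hpp.one_lt
    set s : ℝ := Real.log p / Real.log N with hs
    have hs0 : 0 ≤ s := div_nonneg (Real.log_nonneg hp1.le) hlogN.le
    have hs1 : s ≤ 1 := by
      rw [hs, div_le_one hlogN]
      exact Real.log_le_log hp0 (by exact_mod_cast hpN.le)
    have h1 : (p : ℝ) ^ (c / Real.log N - 1) = Real.exp (c * s) * (1 / p) := by
      rw [Real.rpow_sub hp0, Real.rpow_one, Real.rpow_def_of_pos hp0, hs]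
      rw [div_eq_mul_one_div (Real.exp _) (p : ℝ)]
      congr 2; ring
    rw [h1]
    have h2 := exp_mul_le_one_add_of_unit (c := c) hs0 hs1
    calc Real.exp (c * s) * (1 / p) ≤ (1 + s * (Real.exp c - 1)) * (1 / p) :=
          mul_le_mul_of_nonneg_right h2 (by positivity)
      _ = 1 / p + (Real.exp c - 1) / Real.log N * (Real.log p / p) := by rw [hs]; ring
  refine (Finset.sum_le_sum hpt).trans ?_
  rw [Finset.sum_add_distrib, ← Finset.mul_sum]
  -- `primesBelow N ⊆ primesLE N`
  have hsub : N.primesBelow ⊆ Nat.primesLE N := by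
    intro p hp
    rw [Nat.mem_primesBelow] at hp
    rw [Nat.mem_primesLE]
    exact ⟨hp.1.le, hp.2⟩
  have h1 : ∑ p ∈ N.primesBelow, (1 : ℝ) / p ≤ Real.log (Real.log N) + 4 :=
    (Finset.sum_le_sum_of_subset_of_nonneg hsub fun p _ _ => by positivity).trans
      (Literature.NumberTheory.LFunctions.MertensBound.sum_inv_prime_le N hN)
  have h2 : ∑ p ∈ N.primesBelow, Real.log p / p ≤ Real.log N + Real.log 4 :=
    (Finset.sum_le_sum_of_subset_of_nonneg hsub fun p hp _ => by
      have := (Nat.mem_primesLE.1 hp).2.one_lt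
      exact div_nonneg (Real.log_nonneg (by exact_mod_cast this.le)) (Nat.cast_nonneg p)).trans
      (Literature.NumberTheory.LFunctions.MertensBound.sum_log_div_prime_le N)
  have h3 : (Real.exp c - 1) / Real.log N * ∑ p ∈ N.primesBelow, Real.log p / p ≤
      3 * (Real.exp c - 1) := by
    calc (Real.exp c - 1) / Real.log N * ∑ p ∈ N.primesBelow, Real.log p / p
        ≤ (Real.exp c - 1) / Real.log N * (Real.log N + Real.log 4) :=
          mul_le_mul_of_nonneg_left h2 (by positivity)
      _ = (Real.exp c - 1) * (1 + Real.log 4 / Real.log N) := by field_simp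
      _ ≤ (Real.exp c - 1) * 3 := by
          refine mul_le_mul_of_nonneg_left ?_ hec
          have h4 : Real.log 4 ≤ 2 * Real.log N := by
            rw [show (4 : ℝ) = 2 ^ 2 by norm_num, Real.log_pow]; push_cast
            linarith [Real.log_le_log (by norm_num : (0:ℝ) < 2) hN2]
          have : Real.log 4 / Real.log N ≤ 2 := by rw [div_le_iff₀ hlogN]; linarith
          linarith
      _ = 3 * (Real.exp c - 1) := by ring
  linarith

/-- **The sparse set.**  For `N ≥ 2`, `u`, `Y ≥ 1`, `c ≥ 0` with `σ = c/log N ≤ 1/2`: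
`#{k ∈ [1,u] : ∃ e ∣ k, e N-smooth, Y ≤ e} ≤ u · Y^{−σ} · exp(4 (log log N + 4 + 3(e^c − 1)))`
[cite: Tenenbaum2015, Chapter III.5]. -/
theorem card_largeSmoothDivisor_le {N : ℕ} (hN : 2 ≤ N) (u : ℕ) {Y c : ℝ} (hY : 1 ≤ Y)
    (hc : 0 ≤ c) (hσ : c / Real.log N ≤ 1 / 2) :
    (#((Icc 1 u).filter (fun k => ∃ e ∈ k.divisors, e ∈ Nat.smoothNumbers N ∧ Y ≤ (e : ℝ))) : ℝ) ≤
      u * (Y ^ (-(c / Real.log N)) *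
        Real.exp (4 * (Real.log (Real.log N) + 4 + 3 * (Real.exp c - 1)))) := by
  classical
  set σ : ℝ := c / Real.log N with hσdef
  have hN2 : (2 : ℝ) ≤ N := by exact_mod_cast hN
  have hlogN : 0 < Real.log N := Real.log_pos (by linarith)
  have hσ0 : 0 ≤ σ := div_nonneg hc hlogN.le
  have hσ1 : σ < 1 := by linarith
  set S := (Icc 1 u).filter (fun k => ∃ e ∈ k.divisors, e ∈ Nat.smoothNumbers N ∧ Y ≤ (e : ℝ))
    with hS
  set T := ((Icc 1 u).filter (· ∈ Nat.smoothNumbers N)).filter (fun m : ℕ => Y ≤ (m : ℝ)) with hT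
  -- `S ⊆ ⋃_{e ∈ T} multiples of e in [1,u]`
  have hcover : S ⊆ T.biUnion (fun e => (Ioc 0 u).filter (fun k => e ∣ k)) := by
    intro k hk
    rw [hS, Finset.mem_filter, Finset.mem_Icc] at hk
    obtain ⟨⟨hk1, hku⟩, e, he, hsm, hYe⟩ := hk
    rw [Finset.mem_biUnion]
    have hek : e ∣ k := Nat.dvd_of_mem_divisors he
    refine ⟨e, ?_, ?_⟩
    · rw [hT, Finset.mem_filter, Finset.mem_filter, Finset.mem_Icc]
      refine ⟨⟨⟨Nat.pos_of_mem_divisors he, (Nat.le_of_dvd (by omega) hek).trans hku⟩, hsm⟩, hYe⟩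
    · rw [Finset.mem_filter, Finset.mem_Ioc]; exact ⟨⟨by omega, hku⟩, hek⟩
  have hcard : (#S : ℝ) ≤ ∑ e ∈ T, ((u / e : ℕ) : ℝ) := by
    have h1 : #S ≤ ∑ e ∈ T, #((Ioc 0 u).filter (fun k => e ∣ k)) :=
      (Finset.card_le_card hcover).trans Finset.card_biUnion_le
    have h2 : ∀ e ∈ T, #((Ioc 0 u).filter (fun k => e ∣ k)) = u / e :=
      fun e _ => Nat.Ioc_filter_dvd_card_eq_div u e
    rw [Finset.sum_congr rfl h2] at h1
    exact_mod_cast h1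
  have hcard' : (#S : ℝ) ≤ u * ∑ e ∈ T, (1 : ℝ) / e := by
    refine hcard.trans ?_
    rw [Finset.mul_sum]
    refine Finset.sum_le_sum fun e _ => ?_
    rw [mul_one_div]
    exact Nat.cast_div_le
  have htail := Literature.NumberTheory.Multiplicative.SmoothRankin.sum_inv_smooth_tail_le N u hσ0 hσ1 hY
  have hprod := Literature.NumberTheory.Multiplicative.SmoothRankin.prod_inv_one_sub_rpow_le_exp N hσ1
  have hsum := sum_primesBelow_rpow_sub_one_le hN hc
  -- `1/(1 − 2^{σ−1}) ≤ 4`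
  have h2σ : (2 : ℝ) ^ (σ - 1) ≤ 3 / 4 := by
    have h1 : (2 : ℝ) ^ (σ - 1) ≤ (2 : ℝ) ^ (-(1 / 2) : ℝ) :=
      Real.rpow_le_rpow_of_exponent_le (by norm_num) (by linarith)
    have h2 : (2 : ℝ) ^ (-(1 / 2) : ℝ) ≤ 3 / 4 := by
      rw [Real.rpow_neg (by norm_num), ← Real.sqrt_eq_rpow]
      have hs : (4 : ℝ) / 3 ≤ Real.sqrt 2 := by
        rw [show (4 : ℝ) / 3 = Real.sqrt ((4 / 3) ^ 2) by rw [Real.sqrt_sq (by norm_num)]]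
        exact Real.sqrt_le_sqrt (by norm_num)
      calc (Real.sqrt 2)⁻¹ ≤ ((4 : ℝ) / 3)⁻¹ := inv_anti₀ (by norm_num) hs
        _ = 3 / 4 := by norm_num
    exact h1.trans h2
  have hS0 : 0 ≤ ∑ p ∈ N.primesBelow, (p : ℝ) ^ (σ - 1) :=
    Finset.sum_nonneg fun p _ => Real.rpow_nonneg (Nat.cast_nonneg p) _
  have hexp : Real.exp ((∑ p ∈ N.primesBelow, (p : ℝ) ^ (σ - 1)) / (1 - (2 : ℝ) ^ (σ - 1))) ≤
      Real.exp (4 * (Real.log (Real.log N) + 4 + 3 * (Real.exp c - 1))) := by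
    refine Real.exp_le_exp.2 ?_
    rw [div_le_iff₀ (by linarith)]
    have : σ - 1 = c / Real.log N - 1 := by rw [hσdef]
    rw [this] at hS0 ⊢
    nlinarith [hsum, h2σ]
  calc (#S : ℝ) ≤ u * ∑ e ∈ T, (1 : ℝ) / e := hcard'
    _ ≤ u * (Y ^ (-σ) * ∏ p ∈ N.primesBelow, (1 - (p : ℝ) ^ (σ - 1))⁻¹) :=
        mul_le_mul_of_nonneg_left htail (Nat.cast_nonneg u)
    _ ≤ u * (Y ^ (-σ) * Real.exp (4 * (Real.log (Real.log N) + 4 + 3 * (Real.exp c - 1)))) := by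
        refine mul_le_mul_of_nonneg_left (mul_le_mul_of_nonneg_left (hprod.trans hexp)
          (Real.rpow_nonneg (by linarith) _)) (Nat.cast_nonneg u)

end Summit.Parity.GeneralizedHardyLittlewood.Theorems
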